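import Summits.BirchSwinnertonDyer.BirchSwinnertonDyer.Theorems.SchneiderFreeAdditiveX3ResidualPairLines
import Literature.NumberTheory.EllipticCurves.Rank1Residual.GVParityTwistTransportProofs
import HarnessLib

/-!
# THE RESIDUAL PAIR `{θsub, θquot}` IS A `ℚ`-ISOGENY INVARIANT — and two rational lines of one curve carry equal-or-swapped pairs;
# at `p = 3` on the K1 door: the `(−3)`-twist of ANY member of the partner's isogeny class carries the partner's pair (either order)

Cell `bsd-schneider-ideate`, seat `bsd-schneider-door-c5` (prover, generation 29; assembly layer; `--supports` 19177).
PARTITION: board row B6 ∩ X3 ∩ sst-twist, `r = 1`, (G-ord, `e = 2`) half at `p = 3` (2 411 pairs: 686 non-anomalous / 1 725 ANOMALOUS twists)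
of `Rank1Residual.partition` — STRUCTURE THEOREM for the anomalous twin's per-pair assembly; types-the-object-of nothing; closes none of B6's
cells (BSD NOT advanced).  bears_on: K1-door (19177 r3 `GordTwoBranchIMC`; FYI wing 20365).

## Why

Every CHARACTER-level typed input of the Eisenstein literature is phrased «at the residual pair `(θsub, θquot)` of `E[p]`» — Teichmüller lifts
of the characters of `Γ_ℚ` on a rational `p`-line `Φ ≤ E[p]` and on `E[p]/Φ` (`KellerYin2024.IsTeichmullerLiftOn(Quot)`; CGLS 2022 Prop. 1.2.5 /
Cor. 1.2.6, Keller–Yin 2402.12781 [RH] Thm. 1.2.2 / [PWL-θ] Prop. 1.2.5, the Katz frames).  The door's (and cell `bsd-eis`'s) constructions move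
between MEMBERS OF AN ISOGENY CLASS all the time: the good lattice vs the Keller–Yin-normalised member, the partner `V` vs the member `V₁` whose
`(−3)`-twist is the given additive curve `W` (generation 28: `…AnomalousTwistMuZeroOfPartner`, `…UpperGordCellThreeAnomalousOfPartner`).  Generation 28
had to DISPLAY the hypothesis `hab` «`W`'s pair = `V`'s characters, in either order» (FINDING-door-c5-g28 §2b: «true, not derivable from
`IsIsogenous` alone in the tree»).  It IS derivable, and this file derives it: **the unordered pair `{θsub, θquot}` is a function of the `ℚ`-isogeny
class** (§3), so a character-level statement read at ONE member speaks about EVERY member.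

## The argument (finite group theory over tree theorems; no semisimplification, no Brauer–Nesbitt, no Chebotarev)

* §1 ONE CURVE, TWO LINES (`teichmullerPair_eq_or_swap_of_isRationalLine`): rational lines `Φ, Ψ ≤ E[p]` with pairs `(θ₁, θ₂)`, `(η₁, η₂)`.  If
  `Φ = Ψ`: Teichmüller lifts on a cyclic subquotient are unique (cell `bsd-line-x1`'s rigidity `IsTeichmullerLiftOnQuot.eq_of_exists_notMem`).  If
  `Φ ≠ Ψ`: `Φ ⊓ Ψ = 0`, `Φ + Ψ = E[p]`; for `T ∈ Ψ` and the quotient witness `b` of `Φ`, `σT − bT ∈ Φ ⊓ Ψ = 0`, so `Γ_ℚ` acts on `Ψ` through `θ₂`; for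
  `Q = P + T` and the witness `a` of `σ` on `Φ`, `σQ − aQ = σT − aT ∈ Ψ`, so it acts on `E[p]/Ψ` through `θ₁`: the pairs are SWAPPED.
* §2 ALONG A `Γ_ℚ`-EQUIVARIANT `g : E₁[p] → E₂[p]`: if `g` is injective on `Φ`, the image `g(Φ)` is a rational line (cell `b2b-bsdres`'s
  `isRationalLine_map`) carrying `(θ₁, θ₂)`; if `ker g = Φ`, the range `g(E₁[p]) ≅ E₁[p]/Φ` is a rational line (`isRationalLine_range`) carrying
  `(θ₂, θ₁)`.  The one non-formal point is the QUOTIENT character of a line of `E₂[p]` when `g` is not onto: it is pinned by the DETERMINANT — with `a, b`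
  the witnesses of `σ` on `Φ` and `E₁[p]/Φ`, `c` its witness on the line `L ≤ E₂[p]` (`c = a`, resp. `c = b`) and `b′` ANY quotient witness of `L`,
  generation 28's `intCast_mul_eq_cyclotomic_of_stableLine` gives `a·b ≡ χ̄_p(σ) ≡ c·b′ (mod p)` on the two curves, so `b′ ≡ b` (resp. `≡ a`)
  (§0 `forall_smul_sub_zsmul_mem_of_mul_eq_cyclotomic`).
* §3 THE INVARIANCE (`teichmullerPair_eq_or_swap_of_isIsogenous`, `exists_isRationalLine_teichmullerPair_of_isIsogenous`): every `ℚ`-isogenous pair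
  is joined by an isogeny `f` NOT killing `E₁[p]` (cell `b2b-bsdres`'s `exists_isogeny_apply_ne_zero`: peel off factors `[p]`, Silverman Cor. III.4.11,
  tree `Isogeny.exists_eq_comp_zsmul_of_geomTorsion_le_ker`); its restriction `g` to `E₁[p]` is injective on `Φ` or has kernel exactly `Φ` (orders
  `p ∣ p²`, `ker g ≠ E₁[p]`) — `b2b`'s case analysis `exists_isRationalLine_of_isogeny`, now carrying the characters — then §2 and §1.
* §4 AT `p = 3` ON THE DOOR (`teichmullerPair_eq_or_swap_of_negThree_twist_of_isIsogenous`): for `W = C₁ • V₁^(−3)` with `V₁ ~ V`, a rational `3`-line of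
  `V` with pair `(θsub, θquot)` and a rational `3`-line of `W` with pair `(θa, θb)`: `(θa, θb) ∈ {(θsub, θquot), (θquot, θsub)}` — untwist
  (`SchneiderFree.exists_smul_quadraticTwist_eq_of_smul_quadraticTwist_eq`), SWAP onto `V₁` (generation 28's
  `exists_isRationalLine_teichmullerPair_swap_of_negThree_twist`: `χ₋₃ = ω`), §3 along `V ~ V₁`.  This is EXACTLY the displayed hypothesis `hab` of
  p693359 `UpperThreeAnomalousOfPartner.additiveIMCUpperBDPInputManinAtField_three_of_RH_of_PWL_at_partner_of_isIsogenous` and of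
  `muProvider_three_of_RH_of_PWL_at_partner`; `exists_teichmullerPair_eq_or_swap_of_negThree_twist_of_isIsogenous` packages it with the pair's existence.

## What is here (theorems only; no definition, no named fact, no `sorry`)
§2–§4 as above (§0–§1 are part 1, `…ResidualPairLines.lean`: torsion-level reading/writing of the predicates, rigidity, quotient witnesses and
their determinant transfer, two lines of one curve).  Everything for `E/ℚ` elliptic and ANY prime `p` (§4: `p = 3`), any coefficient set `S ⊆ ℚ̄_p`.

HONEST FRAMING: finite group theory / Galois bookkeeping over tree theorems (Silverman III.4.11 and X.5.4 as proved in the tree, Serre's determinant,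
the tree's Teichmüller-lift predicates); CONDITIONAL on nothing; nothing analytic; nothing is closed; BSD is proved for no curve; «closes rung: none».
References: [SilvermanAEC2009] III.4, Cor. III.4.11, Thm. III.6.1 (isogenies, factorisation through `[m]`, dual), X.5 Cor. 5.4 (twist); [Serre1972]
§1.11 (`det ρ̄_{E,p} = χ̄_p`); [KellerYin2024] §1.4 (arXiv:2402.12781v2 TeX L1063–1086: the characters `φ, ψ`), Thm. 1.2.2 / Prop. 1.2.5 (character-level
inputs); [CastellaGrossiLeeSkinner2022] §1.2 (labelling of the pair).  Tree: cell `b2b-bsdres` `GVParityIsogenyClassProofs` / `GVParityTransferProofs`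
/ `GVParityIsogenyProofs`; cell `bsd-line-x1` `EisensteinPrimesResidualPairFromRat`; this seat p688897 (generation 28), p693359.
-/

set_option autoImplicit false
set_option linter.dupNamespace false

noncomputable section

open scoped Classical

open Field WeierstrassCurve
  Literature.NumberTheory.EllipticCurves Literature.NumberTheory.GaloisRepresentations
  Literature.NumberTheory.EllipticCurves.Rank1Residual
  Literature.NumberTheory.EllipticCurves.KellerYin2024
  Summit.BirchSwinnertonDyer.Rank1Residual.GaloisImage
  Summit.BirchSwinnertonDyer.BirchSwinnertonDyer.Theorems.ResidualLineRigidity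
  Summit.BirchSwinnertonDyer.BirchSwinnertonDyer.Theorems.SchneiderFree
  Summit.BirchSwinnertonDyer.BirchSwinnertonDyer.Theorems.SchneiderFreeAdditiveX3.TwistThreeResidualPair

namespace Summit.BirchSwinnertonDyer.BirchSwinnertonDyer.Theorems.SchneiderFreeAdditiveX3.ResidualPairIsogeny

/-! ### §2 Along a `Γ_ℚ`-equivariant `g : E₁[p] → E₂[p]`: the image line and the range -/

section Transport

variable {W₁ W₂ : WeierstrassCurve ℚ} [W₁.IsElliptic] [W₂.IsElliptic] {p : ℕ} [hp : Fact p.Prime] {S : Set (PadicAlgCl p)}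
  (g : geomTorsion W₁ (p : ℤ) →+ geomTorsion W₂ (p : ℤ))
  (hg : ∀ (σ : absoluteGaloisGroup ℚ) (P : geomTorsion W₁ (p : ℤ)), g (σ • P) = σ • g P)

include hg in
/-- **The image line carries the same pair.**  If `g` is injective on the rational line `Φ ≤ E₁[p]` with pair `(θ₁, θ₂)`, then `g(Φ) ≤ E₂[p]` is a
rational line (cell `b2b-bsdres`'s `isRationalLine_map`) with pair `(θ₁, θ₂)`: the witness of `σ` on `Φ` transports, and the quotient witness
transfers by the determinant on both curves (`a·b ≡ χ̄_p(σ) ≡ a·b′`, §0). [cite: Serre1972, §1.11] [cite: KellerYin2024, §1.4 (arXiv:2402.12781v2)] -/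
theorem teichmullerPair_map_of_injOn {Φ : AddSubgroup (geomTorsion W₁ (p : ℤ))} (hΦ : IsRationalLine W₁ p Φ)
    {θ₁ θ₂ : FramedGaloisRep ℚ (padicCoeffIntegers S) 1}
    (h₁ : IsTeichmullerLiftOn S (Φ.map (geomTorsion W₁ (p : ℤ)).subtype) θ₁)
    (h₂ : IsTeichmullerLiftOnQuot S (Φ.map (geomTorsion W₁ (p : ℤ)).subtype) (geomTorsion W₁ (p : ℤ)) θ₂)
    (hinj : ∀ P ∈ Φ, g P = 0 → P = 0) :
    IsRationalLine W₂ p (Φ.map g) ∧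
      IsTeichmullerLiftOn S ((Φ.map g).map (geomTorsion W₂ (p : ℤ)).subtype) θ₁ ∧
      IsTeichmullerLiftOnQuot S ((Φ.map g).map (geomTorsion W₂ (p : ℤ)).subtype) (geomTorsion W₂ (p : ℤ)) θ₂ := by
  have hL : IsRationalLine W₂ p (Φ.map g) := isRationalLine_map g hg hΦ hinj
  -- `σ` acts on `g(Φ)` by its witness on `Φ`
  have hact : ∀ (σ : absoluteGaloisGroup ℚ) {a : ℤ}, (∀ P ∈ Φ, σ • P = a • P) → ∀ P ∈ Φ.map g, σ • P = a • P := by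
    rintro σ a ha _ ⟨P, hP, rfl⟩
    rw [← hg, ha P hP, map_zsmul]
  refine ⟨hL, isTeichmullerLiftOn_of_witness h₁.1 fun σ ↦ ?_, isTeichmullerLiftOnQuot_of_witness h₂.1 fun σ ↦ ?_⟩
  · obtain ⟨a, ha, haΦ⟩ := exists_witness_sub h₁ σ
    exact ⟨a, ha, hact σ haΦ⟩
  · obtain ⟨a, -, haΦ⟩ := exists_witness_sub h₁ σ
    obtain ⟨b, hb, hbΦ⟩ := exists_witness_quot h₂ σ
    exact ⟨b, hb, forall_smul_sub_zsmul_mem_of_mul_eq_cyclotomic hL σ (hact σ haΦ)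
      (intCast_mul_eq_cyclotomic_of_stableLine σ hΦ.1 haΦ hbΦ)⟩

include hg in
/-- **The range carries the swapped pair.**  If the kernel of `g` on `E₁[p]` IS the rational line `Φ` with pair `(θ₁, θ₂)`, then the range
`g(E₁[p]) ≅ E₁[p]/Φ` is a rational line of `E₂[p]` (cell `b2b-bsdres`'s `isRationalLine_range`) with pair `(θ₂, θ₁)`: `Γ_ℚ` acts on it through the
quotient witness of `Φ`, and the quotient witness transfers by the determinant (`a·b ≡ χ̄_p(σ) ≡ b·b′`, §0).
[cite: Serre1972, §1.11] [cite: KellerYin2024, §1.4 (arXiv:2402.12781v2)] -/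
theorem teichmullerPair_range_of_ker_eq {Φ : AddSubgroup (geomTorsion W₁ (p : ℤ))} (hΦ : IsRationalLine W₁ p Φ)
    {θ₁ θ₂ : FramedGaloisRep ℚ (padicCoeffIntegers S) 1}
    (h₁ : IsTeichmullerLiftOn S (Φ.map (geomTorsion W₁ (p : ℤ)).subtype) θ₁)
    (h₂ : IsTeichmullerLiftOnQuot S (Φ.map (geomTorsion W₁ (p : ℤ)).subtype) (geomTorsion W₁ (p : ℤ)) θ₂)
    (hker : g.ker = Φ) :
    IsRationalLine W₂ p g.range ∧
      IsTeichmullerLiftOn S (g.range.map (geomTorsion W₂ (p : ℤ)).subtype) θ₂ ∧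
      IsTeichmullerLiftOnQuot S (g.range.map (geomTorsion W₂ (p : ℤ)).subtype) (geomTorsion W₂ (p : ℤ)) θ₁ := by
  have hL : IsRationalLine W₂ p g.range :=
    isRationalLine_range g hg (Literature.NumberTheory.EllipticCurves.Rank1Residual.natCard_geomTorsion W₁ p)
      (by rw [hker]; exact hΦ.1)
  -- `σ` acts on the range by the quotient witness of `Φ`
  have hact : ∀ (σ : absoluteGaloisGroup ℚ) {b : ℤ}, (∀ Q : geomTorsion W₁ (p : ℤ), σ • Q - b • Q ∈ Φ) →
      ∀ P ∈ g.range, σ • P = b • P := by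
    intro σ b hb P hP
    obtain ⟨Q, rfl⟩ := AddMonoidHom.mem_range.mp hP
    have hk : σ • Q - b • Q ∈ g.ker := by rw [hker]; exact hb Q
    rw [AddMonoidHom.mem_ker, map_sub, hg, map_zsmul, sub_eq_zero] at hk
    exact hk
  refine ⟨hL, isTeichmullerLiftOn_of_witness h₂.1 fun σ ↦ ?_, isTeichmullerLiftOnQuot_of_witness h₁.1 fun σ ↦ ?_⟩
  · obtain ⟨b, hb, hbΦ⟩ := exists_witness_quot h₂ σ
    exact ⟨b, hb, hact σ hbΦ⟩
  · obtain ⟨a, ha, haΦ⟩ := exists_witness_sub h₁ σ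
    obtain ⟨b, -, hbΦ⟩ := exists_witness_quot h₂ σ
    refine ⟨a, ha, forall_smul_sub_zsmul_mem_of_mul_eq_cyclotomic hL σ (hact σ hbΦ) ?_⟩
    rw [mul_comm]
    exact intCast_mul_eq_cyclotomic_of_stableLine σ hΦ.1 haΦ hbΦ

end Transport

/-! ### §3 THE RESIDUAL PAIR IS A `ℚ`-ISOGENY INVARIANT -/

section Invariance

variable {W₁ W₂ : WeierstrassCurve ℚ} [W₁.IsElliptic] [W₂.IsElliptic] {p : ℕ} [hp : Fact p.Prime] {S : Set (PadicAlgCl p)}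

/-- **Along an isogeny not killing `E₁[p]`, the residual pair TRANSPORTS (up to order).**  Let `f : E₁ → E₂` be a `ℚ`-isogeny with
`E₁[p] ⊄ ker f` and `Φ ≤ E₁[p]` a rational line with Teichmüller pair `(θ₁, θ₂)`.  Then `E₂[p]` has a rational line with pair `(θ₁, θ₂)` or one
with pair `(θ₂, θ₁)`: `f` restricts to a `Γ_ℚ`-equivariant `g : E₁[p] → E₂[p]`; if `g` is injective on `Φ`, `g(Φ)` carries `(θ₁, θ₂)` (§2);
otherwise `Φ ≤ ker g ≠ E₁[p]`, so `ker g = Φ` (orders `p ∣ p²`) and `g(E₁[p]) ≅ E₁[p]/Φ` carries `(θ₂, θ₁)` (§2).  (The case analysis is cell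
`b2b-bsdres`'s `exists_isRationalLine_of_isogeny`, now carrying the characters.)
[cite: SilvermanAEC2009, III.4 (isogenies), Cor. III.4.11] [cite: Serre1972, §1.11] [cite: KellerYin2024, §1.4 (arXiv:2402.12781v2)] -/
theorem exists_isRationalLine_teichmullerPair_of_isogeny_apply_ne_zero (f : Isogeny W₁ W₂)
    (hf : ∃ P : geomPoints W₁, P ∈ geomTorsion W₁ (p : ℤ) ∧ f P ≠ 0)
    {Φ : AddSubgroup (geomTorsion W₁ (p : ℤ))} (hΦ : IsRationalLine W₁ p Φ)
    {θ₁ θ₂ : FramedGaloisRep ℚ (padicCoeffIntegers S) 1}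
    (h₁ : IsTeichmullerLiftOn S (Φ.map (geomTorsion W₁ (p : ℤ)).subtype) θ₁)
    (h₂ : IsTeichmullerLiftOnQuot S (Φ.map (geomTorsion W₁ (p : ℤ)).subtype) (geomTorsion W₁ (p : ℤ)) θ₂) :
    ∃ L : AddSubgroup (geomTorsion W₂ (p : ℤ)), IsRationalLine W₂ p L ∧
      ((IsTeichmullerLiftOn S (L.map (geomTorsion W₂ (p : ℤ)).subtype) θ₁ ∧
          IsTeichmullerLiftOnQuot S (L.map (geomTorsion W₂ (p : ℤ)).subtype) (geomTorsion W₂ (p : ℤ)) θ₂) ∨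
        (IsTeichmullerLiftOn S (L.map (geomTorsion W₂ (p : ℤ)).subtype) θ₂ ∧
          IsTeichmullerLiftOnQuot S (L.map (geomTorsion W₂ (p : ℤ)).subtype) (geomTorsion W₂ (p : ℤ)) θ₁)) := by
  have hpp : p.Prime := hp.out
  -- the restriction `g` of `f` to `E₁[p] → E₂[p]`
  have hmem : ∀ P : geomTorsion W₁ (p : ℤ), f (P : geomPoints W₁) ∈ geomTorsion W₂ (p : ℤ) := by
    intro P
    have h0 : (p : ℤ) • (P : geomPoints W₁) = 0 := (Submodule.mem_torsionBy_iff (p : ℤ) _).mp P.2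
    have h1 : (p : ℤ) • f (P : geomPoints W₁) = 0 := by rw [← map_zsmul, h0, map_zero]
    exact (Submodule.mem_torsionBy_iff (p : ℤ) _).mpr h1
  let g : geomTorsion W₁ (p : ℤ) →+ geomTorsion W₂ (p : ℤ) :=
    { toFun := fun P ↦ ⟨f (P : geomPoints W₁), hmem P⟩
      map_zero' := Subtype.ext (by simp)
      map_add' := fun P Q ↦ Subtype.ext (by simp) }
  have hgval : ∀ P : geomTorsion W₁ (p : ℤ), (g P : geomPoints W₂) = f (P : geomPoints W₁) := fun _ ↦ rfl
  have hg : ∀ (σ : absoluteGaloisGroup ℚ) (P : geomTorsion W₁ (p : ℤ)), g (σ • P) = σ • g P := by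
    intro σ P
    apply Subtype.ext
    rw [hgval, AddSubgroup.torsionBy.coe_smul, AddSubgroup.torsionBy.coe_smul, hgval, f.map_smul]
  have hE : Nat.card (geomTorsion W₁ (p : ℤ)) = p ^ 2 :=
    Literature.NumberTheory.EllipticCurves.Rank1Residual.natCard_geomTorsion W₁ p
  haveI : Finite (geomTorsion W₁ (p : ℤ)) := Nat.finite_of_card_ne_zero (by rw [hE]; exact pow_ne_zero 2 hpp.ne_zero)
  by_cases hinj : ∀ P ∈ Φ, g P = 0 → P = 0
  · -- `g` injective on `Φ`: the image line carries `(θ₁, θ₂)`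
    obtain ⟨hL, hs, hq⟩ := teichmullerPair_map_of_injOn g hg hΦ h₁ h₂ hinj
    exact ⟨Φ.map g, hL, Or.inl ⟨hs, hq⟩⟩
  · -- otherwise `ker g = Φ` and the range carries `(θ₂, θ₁)`
    push Not at hinj
    obtain ⟨P₁, hP₁Φ, hP₁g, hP₁0⟩ := hinj
    have hle : Φ ≤ g.ker := by
      rw [← Summit.BirchSwinnertonDyer.Rank1Residual.Additive.MixedCongruence.zmultiples_eq_of_mem_of_ne_zero hΦ.1 hP₁Φ hP₁0,
        AddSubgroup.zmultiples_le, AddMonoidHom.mem_ker]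
      exact hP₁g
    have hdvd : Nat.card g.ker ∣ p ^ 2 := hE ▸ g.ker.card_addSubgroup_dvd_card
    obtain ⟨i, hi, hKi⟩ := (Nat.dvd_prime_pow hpp).mp hdvd
    have hK : Nat.card g.ker = p := by
      interval_cases i
      · exfalso
        have hbot : g.ker = ⊥ := AddSubgroup.card_eq_one.mp (by simpa using hKi)
        have : P₁ ∈ g.ker := hle hP₁Φ
        rw [hbot, AddSubgroup.mem_bot] at this
        exact hP₁0 this
      · simpa using hKi
      · exfalso
        have htop : g.ker = ⊤ := AddSubgroup.eq_top_of_card_eq _ (by rw [hKi, hE])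
        obtain ⟨P, hP, hfP⟩ := hf
        have hmem1 : (⟨P, hP⟩ : geomTorsion W₁ (p : ℤ)) ∈ g.ker := by rw [htop]; exact AddSubgroup.mem_top _
        rw [AddMonoidHom.mem_ker] at hmem1
        exact hfP (by simpa [hgval] using congrArg Subtype.val hmem1)
    have hker : g.ker = Φ := (AddSubgroup.eq_of_le_of_card_ge hle (by rw [hK, hΦ.1])).symm
    obtain ⟨hL, hs, hq⟩ := teichmullerPair_range_of_ker_eq g hg hΦ h₁ h₂ hker
    exact ⟨g.range, hL, Or.inr ⟨hs, hq⟩⟩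

/-- **Along an isogeny not killing `E₁[p]`, the residual pairs of `E₁` and `E₂` agree up to order**: with `Ψ ≤ E₂[p]` a rational line with pair
`(η₁, η₂)`, `(η₁, η₂) ∈ {(θ₁, θ₂), (θ₂, θ₁)}` — the transported line of `exists_isRationalLine_teichmullerPair_of_isogeny_apply_ne_zero` compared
with `Ψ` inside `E₂[p]` by §1. [cite: SilvermanAEC2009, III.4, Cor. III.4.11] [cite: Serre1972, §1.11] [cite: KellerYin2024, §1.4 (arXiv:2402.12781v2)] -/
theorem teichmullerPair_eq_or_swap_of_isogeny_apply_ne_zero (f : Isogeny W₁ W₂)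
    (hf : ∃ P : geomPoints W₁, P ∈ geomTorsion W₁ (p : ℤ) ∧ f P ≠ 0)
    {Φ : AddSubgroup (geomTorsion W₁ (p : ℤ))} (hΦ : IsRationalLine W₁ p Φ)
    {θ₁ θ₂ : FramedGaloisRep ℚ (padicCoeffIntegers S) 1}
    (h₁ : IsTeichmullerLiftOn S (Φ.map (geomTorsion W₁ (p : ℤ)).subtype) θ₁)
    (h₂ : IsTeichmullerLiftOnQuot S (Φ.map (geomTorsion W₁ (p : ℤ)).subtype) (geomTorsion W₁ (p : ℤ)) θ₂)
    {Ψ : AddSubgroup (geomTorsion W₂ (p : ℤ))} (hΨ : IsRationalLine W₂ p Ψ)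
    {η₁ η₂ : FramedGaloisRep ℚ (padicCoeffIntegers S) 1}
    (k₁ : IsTeichmullerLiftOn S (Ψ.map (geomTorsion W₂ (p : ℤ)).subtype) η₁)
    (k₂ : IsTeichmullerLiftOnQuot S (Ψ.map (geomTorsion W₂ (p : ℤ)).subtype) (geomTorsion W₂ (p : ℤ)) η₂) :
    (η₁ = θ₁ ∧ η₂ = θ₂) ∨ (η₁ = θ₂ ∧ η₂ = θ₁) := by
  obtain ⟨L, hL, hor⟩ := exists_isRationalLine_teichmullerPair_of_isogeny_apply_ne_zero f hf hΦ h₁ h₂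
  rcases hor with ⟨hs, hq⟩ | ⟨hs, hq⟩
  · exact teichmullerPair_eq_or_swap_of_isRationalLine hL hs hq hΨ k₁ k₂
  · exact (teichmullerPair_eq_or_swap_of_isRationalLine hL hs hq hΨ k₁ k₂).symm

/-- **THE RESIDUAL PAIR IS A `ℚ`-ISOGENY INVARIANT.**  For `ℚ`-isogenous elliptic curves `E₁ ~ E₂` and rational `p`-lines `Φ ≤ E₁[p]`, `Ψ ≤ E₂[p]`
with Teichmüller pairs `(θ₁, θ₂)` and `(η₁, η₂)` (`KellerYin2024.IsTeichmullerLiftOn(Quot)`, any coefficient set): `(η₁, η₂) = (θ₁, θ₂)` or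
`(η₁, η₂) = (θ₂, θ₁)`.  Every isogenous pair is joined by an isogeny not killing `E₁[p]` (cell `b2b-bsdres`'s `exists_isogeny_apply_ne_zero`:
peel off factors `[p]` by Silverman III.4.11), then `teichmullerPair_eq_or_swap_of_isogeny_apply_ne_zero`.  In words: the unordered pair of
characters `{φ, ψ}` with `E[p]^ss ≅ 𝔽(φ) ⊕ 𝔽(ψ)` is a function of the `ℚ`-isogeny class — so every CHARACTER-level statement «at the residual
pair» read at ONE member of the class speaks about every member.
[cite: SilvermanAEC2009, III.4, Cor. III.4.11, III.6.1] [cite: Serre1972, §1.11] [cite: KellerYin2024, §1.4 (arXiv:2402.12781v2 TeX L1063–1086)] -/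
theorem teichmullerPair_eq_or_swap_of_isIsogenous (hiso : IsIsogenous W₁ W₂)
    {Φ : AddSubgroup (geomTorsion W₁ (p : ℤ))} (hΦ : IsRationalLine W₁ p Φ)
    {θ₁ θ₂ : FramedGaloisRep ℚ (padicCoeffIntegers S) 1}
    (h₁ : IsTeichmullerLiftOn S (Φ.map (geomTorsion W₁ (p : ℤ)).subtype) θ₁)
    (h₂ : IsTeichmullerLiftOnQuot S (Φ.map (geomTorsion W₁ (p : ℤ)).subtype) (geomTorsion W₁ (p : ℤ)) θ₂)
    {Ψ : AddSubgroup (geomTorsion W₂ (p : ℤ))} (hΨ : IsRationalLine W₂ p Ψ)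
    {η₁ η₂ : FramedGaloisRep ℚ (padicCoeffIntegers S) 1}
    (k₁ : IsTeichmullerLiftOn S (Ψ.map (geomTorsion W₂ (p : ℤ)).subtype) η₁)
    (k₂ : IsTeichmullerLiftOnQuot S (Ψ.map (geomTorsion W₂ (p : ℤ)).subtype) (geomTorsion W₂ (p : ℤ)) η₂) :
    (η₁ = θ₁ ∧ η₂ = θ₂) ∨ (η₁ = θ₂ ∧ η₂ = θ₁) := by
  obtain ⟨f, P, hP, hfP⟩ := exists_isogeny_apply_ne_zero (p := p) hiso
  exact teichmullerPair_eq_or_swap_of_isogeny_apply_ne_zero f ⟨P, hP, hfP⟩ hΦ h₁ h₂ hΨ k₁ k₂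

/-- **Along an isogeny the residual pair TRANSPORTS** (existence form on the class): if `E₁ ~ E₂` over `ℚ` and `Φ ≤ E₁[p]` is a rational line with
pair `(θ₁, θ₂)`, then `E₂[p]` has a rational line with pair `(θ₁, θ₂)` or one with pair `(θ₂, θ₁)`. [cite: SilvermanAEC2009, Cor. III.4.11]
[cite: KellerYin2024, §1.4 (arXiv:2402.12781v2)] -/
theorem exists_isRationalLine_teichmullerPair_of_isIsogenous (hiso : IsIsogenous W₁ W₂)
    {Φ : AddSubgroup (geomTorsion W₁ (p : ℤ))} (hΦ : IsRationalLine W₁ p Φ)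
    {θ₁ θ₂ : FramedGaloisRep ℚ (padicCoeffIntegers S) 1}
    (h₁ : IsTeichmullerLiftOn S (Φ.map (geomTorsion W₁ (p : ℤ)).subtype) θ₁)
    (h₂ : IsTeichmullerLiftOnQuot S (Φ.map (geomTorsion W₁ (p : ℤ)).subtype) (geomTorsion W₁ (p : ℤ)) θ₂) :
    ∃ L : AddSubgroup (geomTorsion W₂ (p : ℤ)), IsRationalLine W₂ p L ∧
      ((IsTeichmullerLiftOn S (L.map (geomTorsion W₂ (p : ℤ)).subtype) θ₁ ∧
          IsTeichmullerLiftOnQuot S (L.map (geomTorsion W₂ (p : ℤ)).subtype) (geomTorsion W₂ (p : ℤ)) θ₂) ∨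
        (IsTeichmullerLiftOn S (L.map (geomTorsion W₂ (p : ℤ)).subtype) θ₂ ∧
          IsTeichmullerLiftOnQuot S (L.map (geomTorsion W₂ (p : ℤ)).subtype) (geomTorsion W₂ (p : ℤ)) θ₁)) := by
  obtain ⟨f, P, hP, hfP⟩ := exists_isogeny_apply_ne_zero (p := p) hiso
  exact exists_isRationalLine_teichmullerPair_of_isogeny_apply_ne_zero f ⟨P, hP, hfP⟩ hΦ h₁ h₂

end Invariance

/-! ### §4 At `p = 3` on the K1 door: the `(−3)`-twist of a partner-class member carries the partner's pair (either order) -/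

section TwistThree

variable {V V₁ W : WeierstrassCurve ℚ} [V.IsElliptic] [V₁.IsElliptic] [W.IsElliptic] {S : Set (PadicAlgCl 3)}

/-- **The displayed hypothesis `hab` of generation 28's `…AnomalousOfPartner` files is a THEOREM.**  Let `W = C₁ • V₁^(−3)` with `V₁ ~ V` over `ℚ`,
`Φ ≤ V[3]` a rational `3`-line with Teichmüller pair `(θsub, θquot)` and `Ψ ≤ W[3]` a rational `3`-line with pair `(θa, θb)`.  Then
`(θa, θb) = (θsub, θquot)` or `(θa, θb) = (θquot, θsub)`: untwist (`V₁ = C′ • W^(−3)`), SWAP the pair of `Ψ` onto a rational line of `V₁` with pair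
`(θb, θa)` (generation 28's `exists_isRationalLine_teichmullerPair_swap_of_negThree_twist`), and compare with `V`'s pair along `V ~ V₁` (§3).
[cite: SilvermanAEC2009, X.5 Cor. 5.4, Cor. III.4.11] [cite: KellerYin2024, §1.4 (arXiv:2402.12781v2)] -/
theorem teichmullerPair_eq_or_swap_of_negThree_twist_of_isIsogenous (C₁ : VariableChange ℚ)
    (hC₁ : C₁ • V₁.quadraticTwist (-3 : ℚ) = W) (hiso : V₁.IsIsogenous V)
    {Φ : AddSubgroup (geomTorsion V ((3 : ℕ) : ℤ))} (hΦ : IsRationalLine V 3 Φ)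
    {θsub θquot : FramedGaloisRep ℚ (padicCoeffIntegers S) 1}
    (hsub : IsTeichmullerLiftOn S (Φ.map (geomTorsion V ((3 : ℕ) : ℤ)).subtype) θsub)
    (hquot : IsTeichmullerLiftOnQuot S (Φ.map (geomTorsion V ((3 : ℕ) : ℤ)).subtype) (geomTorsion V ((3 : ℕ) : ℤ)) θquot)
    {Ψ : AddSubgroup (geomTorsion W ((3 : ℕ) : ℤ))} (hΨ : IsRationalLine W 3 Ψ)
    {θa θb : FramedGaloisRep ℚ (padicCoeffIntegers S) 1}
    (hsW : IsTeichmullerLiftOn S (Ψ.map (geomTorsion W ((3 : ℕ) : ℤ)).subtype) θa)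
    (hqW : IsTeichmullerLiftOnQuot S (Ψ.map (geomTorsion W ((3 : ℕ) : ℤ)).subtype) (geomTorsion W ((3 : ℕ) : ℤ)) θb) :
    (θa = θsub ∧ θb = θquot) ∨ (θa = θquot ∧ θb = θsub) := by
  have hd0 : (-3 : ℚ) ≠ 0 := by norm_num
  -- undo the twist and swap the pair of `Ψ` onto `V₁`
  obtain ⟨C', hC'⟩ := exists_smul_quadraticTwist_eq_of_smul_quadraticTwist_eq V₁ W hd0 C₁ hC₁
  obtain ⟨Ψ₁, hΨ₁, h1, h2⟩ := exists_isRationalLine_teichmullerPair_swap_of_negThree_twist C' hC' hΨ hsW hqW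
  -- compare with `V`'s pair along `V ~ V₁`
  rcases teichmullerPair_eq_or_swap_of_isIsogenous hiso.symm_of_charZero hΦ hsub hquot hΨ₁ h1 h2 with ⟨hb, ha⟩ | ⟨hb, ha⟩
  · exact Or.inr ⟨ha, hb⟩
  · exact Or.inl ⟨ha, hb⟩

/-- **Every member of the `(−3)`-twisted class carries the partner's pair.**  With `W = C₁ • V₁^(−3)`, `V₁ ~ V`, and `Φ ≤ V[3]` a rational line with
pair `(θsub, θquot)`: `W[3]` HAS a rational line, and EVERY rational `3`-line of `W` has a Teichmüller pair (coefficients `ℤ₃`) equal to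
`(θsub, θquot)` or to `(θquot, θsub)` — the data generation 28's μ-provider `muProvider_three_of_RH_of_PWL_at_partner` consumes.
[cite: SilvermanAEC2009, X.5 Cor. 5.4, Cor. III.4.11] [cite: KellerYin2024, §1.4 (arXiv:2402.12781v2)] -/
theorem exists_teichmullerPair_eq_or_swap_of_negThree_twist_of_isIsogenous (C₁ : VariableChange ℚ)
    (hC₁ : C₁ • V₁.quadraticTwist (-3 : ℚ) = W) (hiso : V₁.IsIsogenous V)
    {Φ : AddSubgroup (geomTorsion V ((3 : ℕ) : ℤ))} (hΦ : IsRationalLine V 3 Φ)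
    {θsub θquot : FramedGaloisRep ℚ (padicCoeffIntegers (∅ : Set (PadicAlgCl 3))) 1}
    (hsub : IsTeichmullerLiftOn (∅ : Set (PadicAlgCl 3)) (Φ.map (geomTorsion V ((3 : ℕ) : ℤ)).subtype) θsub)
    (hquot : IsTeichmullerLiftOnQuot (∅ : Set (PadicAlgCl 3)) (Φ.map (geomTorsion V ((3 : ℕ) : ℤ)).subtype)
      (geomTorsion V ((3 : ℕ) : ℤ)) θquot)
    {Ψ : AddSubgroup (geomTorsion W ((3 : ℕ) : ℤ))} (hΨ : IsRationalLine W 3 Ψ) :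
    ∃ (θa θb : FramedGaloisRep ℚ (padicCoeffIntegers (∅ : Set (PadicAlgCl 3))) 1),
      ((θa = θsub ∧ θb = θquot) ∨ (θa = θquot ∧ θb = θsub)) ∧
      IsTeichmullerLiftOn (∅ : Set (PadicAlgCl 3)) (Ψ.map (geomTorsion W ((3 : ℕ) : ℤ)).subtype) θa ∧
      IsTeichmullerLiftOnQuot (∅ : Set (PadicAlgCl 3)) (Ψ.map (geomTorsion W ((3 : ℕ) : ℤ)).subtype)
        (geomTorsion W ((3 : ℕ) : ℤ)) θb := by
  obtain ⟨θa, θb, hsW, hqW⟩ := EisensteinCharacterInvariantsAtThreeCharacterCutEq.exists_teichmullerPair_of_line W 3 hΨ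
  exact ⟨θa, θb, teichmullerPair_eq_or_swap_of_negThree_twist_of_isIsogenous C₁ hC₁ hiso hΦ hsub hquot hΨ hsW hqW, hsW, hqW⟩

end TwistThree

end Summit.BirchSwinnertonDyer.BirchSwinnertonDyer.Theorems.SchneiderFreeAdditiveX3.ResidualPairIsogeny

end
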